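import Literature.Topology.PlanarFoliations.ProngStar
import Literature.Topology.FourManifolds.TautFoliationsVertexHeight
import HarnessLib

/-!
# The contour foliation at an interior vertex is a four-prong star

Topic: sequel to `TautFoliationsVertexSectors.lean`, `TautFoliationsVertexHeight.lean` and
`Literature/Topology/PlanarFoliations/ProngStar.lean`. For a disc in checkerboard cone position
`P` and an interior vertex `v` of its grid (a puncture of the contour foliation `P.contourFol`),
we construct the **four-prong star** `P.vertexStar : ProngStar (P.contourFol ho) planeEmb v 4`
(the `C⁰` saddle structure of Camacho–Lins Neto Ch. VI §2 / Ch. VII §2 at the vertices of a disc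
in general position): the sector `j` consists of the points `spt v ℓ j (sgn j) (b, t)`,
`b ∈ [0, ρ_b]`, `|t| ≤ u₀`, whose scaled `b`-coordinate and common height `Hv` lie in the square
`[0, ρ] × [-ρ, ρ]`; the coordinates are `(κ · bco, Hv)` (`κ = ρ / ρ_b`); injectivity comes from
the strict monotonicity of `Hv` along the broken rays (`strictMonoOn_Hv_spt`), surjectivity
from the intermediate value theorem along them, the gluing of consecutive sectors along the
diagonals of the squares from `spt_axis_succ`, and the foliated property from the description
of the atlas of the contour foliation (renormalised, oriented plane charts reading the height of
a flow box of `F`, `chart_height`) together with the transverse orientation of `F`.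

* `ConePosition.VtxConst`, `ConePosition.exists_vtxConst`, `ConePosition.vtx` (**definition** /
  **proved**: the constants `r, u₀, ρ, ρ_b` of the construction);
* `ConePosition.vK`, `ConePosition.vS`, `ConePosition.vb`, `ConePosition.vH` (**definitions**);
* `ConePosition.vertexStar` (**definition**, all fields **proved**).

## References

* C. Camacho, A. Lins Neto, *Geometric Theory of Foliations*, Birkhäuser (1985), Ch. VI §2,
  Ch. VII §2 [CamachoLinsNeto1985].
-/

noncomputable section

open Set Filter Metric Function
open scoped Topology

namespace Literature.Topology.FourManifolds

namespace Foliation.ConePosition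

open ConeSquare SquareGrid VertexSector Literature.Topology.PlanarFoliations

variable {B : Type*} [NormedAddCommGroup B] [NormedSpace ℝ B] {M : Type*} [TopologicalSpace M]
  {F : Foliation B M} {f : ℝ × ℝ → M} {c₀ : ℝ × ℝ} {L : ℝ} {hL : 0 < L} (P : ConePosition F f c₀ hL)
  {v : ℝ × ℝ} (hv : v ∈ P.gr.vertices) (hvb : v ∈ ball P.gr.bigCentre (P.gr.n * P.gr.ℓ))
  (ho : F.IsTransverselyOriented)

/-! ## Complex coordinates -/

/-- The complex number with given real coordinates. [folklore] -/
def toC (p : ℝ × ℝ) : ℂ := ⟨p.1, p.2⟩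

/-- `toR ∘ toC = id`. [folklore] -/
@[simp] theorem toR_toC (p : ℝ × ℝ) : toR (toC p) = p := rfl

/-- `toC ∘ toR = id`. [folklore] -/
@[simp] theorem toC_toR (z : ℂ) : toC (toR z) = z := rfl

/-- `toC` is continuous. [folklore] -/
theorem continuous_toC : Continuous toC := Complex.equivRealProdCLM.symm.continuous

/-! ## The constants of the construction -/

/-- The increasing correspondences of the boxes of the eight squares at `v` with the common
height, on `closedBall v r`. [folklore] -/
def Corr (r : ℝ) : Prop :=
  ∀ j, (∀ z ∈ closedBall v r ∩ P.gr.sq (P.qU hv hvb j), ∀ z' ∈ closedBall v r ∩ P.gr.sq (P.qU hv hvb j),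
      (height (P.box (P.qU hv hvb j)) (P.fill P.apex z) < height (P.box (P.qU hv hvb j)) (P.fill P.apex z') ↔
        P.Hv hv hvb z < P.Hv hv hvb z')) ∧
    (∀ z ∈ closedBall v r ∩ P.gr.sq (P.qL hv hvb j), ∀ z' ∈ closedBall v r ∩ P.gr.sq (P.qL hv hvb j),
      (height (P.box (P.qL hv hvb j)) (P.fill P.apex z) < height (P.box (P.qL hv hvb j)) (P.fill P.apex z') ↔
        P.Hv hv hvb z < P.Hv hv hvb z'))

/-- **The constants of the vertex star.** [folklore] -/
structure VtxConst where
  /-- the vertex radius -/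
  r : ℝ
  /-- the half width of the sectors in the ordinate -/
  u₀ : ℝ
  /-- the size of the model square -/
  ρ : ℝ
  /-- the width of the sectors in the abscissa -/
  ρb : ℝ
  r_pos : 0 < r
  r_le : r ≤ P.gr.ℓ
  r_gap : r < P.gr.n * P.gr.ℓ - dist v P.gr.bigCentre
  corr : P.Corr hv hvb r
  u₀_pos : 0 < u₀
  u₀_lt : u₀ < r / 2
  ρ_pos : 0 < ρ
  ρb_pos : 0 < ρb
  ρb_le : ρb ≤ r / 2
  top : ∀ j, ∀ b ∈ Icc 0 ρb, ρ ≤ P.Hv hv hvb (spt v P.gr.ℓ j (P.sgn hv hvb j) (b, u₀))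
  bot : ∀ j, ∀ b ∈ Icc 0 ρb, P.Hv hv hvb (spt v P.gr.ℓ j (P.sgn hv hvb j) (b, -u₀)) ≤ -ρ

include ho in
/-- **The constants exist.** [folklore] -/
theorem exists_vtxConst : Nonempty (P.VtxConst hv hvb) := by
  have hℓ := P.gr.hℓ
  obtain ⟨r, ⟨hr0, hrℓ⟩, hrgap, hcorr⟩ := P.exists_vertexRadius hv hvb ho
  set u₀ := r / 4 with hu₀
  have hu₀pos : 0 < u₀ := by positivity
  have hu₀I : u₀ ∈ Ico 0 P.gr.ℓ := ⟨hu₀pos.le, by linarith⟩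
  -- the heights at the ends of the axes
  have hcont := P.continuousOn_Hv hv hvb hrℓ hrgap
  have hmem : ∀ j, ∀ b ∈ Icc 0 (r / 2), ∀ t ∈ Icc (-u₀) u₀, spt v P.gr.ℓ j (P.sgn hv hvb j) (b, t) ∈ closedBall v r :=
    fun j b hb t ht ↦ by
      rw [mem_closedBall]
      have h := dist_spt_le (v := v) hℓ j (P.isSg_sgn hv hvb j) (u := t) ⟨hb.1, hb.2.trans (by linarith)⟩
      have : |t| ≤ u₀ := abs_le.2 ⟨ht.1, ht.2⟩
      linarith [hb.2]
  have huI : u₀ ∈ Icc (-u₀) u₀ := ⟨by linarith, le_rfl⟩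
  have hnuI : -u₀ ∈ Icc (-u₀) u₀ := ⟨le_rfl, by linarith⟩
  -- positive / negative values on the axes
  have hsign : ∀ j {t : ℝ}, t ∈ Icc (-u₀) u₀ →
      (0 < t → 0 < P.Hv hv hvb (spt v P.gr.ℓ j (P.sgn hv hvb j) (0, t))) ∧
        (t < 0 → P.Hv hv hvb (spt v P.gr.ℓ j (P.sgn hv hvb j) (0, t)) < 0) :=
    fun j t ht ↦ P.Hv_spt_axis_sign hv hvb hcorr j hu₀I (by linarith) ht
  set A : ZMod 4 → ℝ := fun j ↦ min (P.Hv hv hvb (spt v P.gr.ℓ j (P.sgn hv hvb j) (0, u₀)))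
    (-P.Hv hv hvb (spt v P.gr.ℓ j (P.sgn hv hvb j) (0, -u₀))) with hA
  have hApos : ∀ j, 0 < A j := fun j ↦ lt_min ((hsign j huI).1 hu₀pos) (by linarith [(hsign j hnuI).2 (by linarith)])
  obtain ⟨j₀, -, hj₀⟩ := Finset.exists_min_image Finset.univ A Finset.univ_nonempty
  set ρ := A j₀ / 2 with hρ
  have hρpos : 0 < ρ := by rw [hρ]; linarith [hApos j₀]
  have hρA : ∀ j, 2 * ρ ≤ A j := fun j ↦ by rw [hρ]; linarith [hj₀ j (Finset.mem_univ j)]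
  -- continuity in `b` at `b = 0` of the heights at the ends
  have key : ∀ j (t : ℝ), t ∈ Icc (-u₀) u₀ →
      ContinuousWithinAt (fun b ↦ P.Hv hv hvb (spt v P.gr.ℓ j (P.sgn hv hvb j) (b, t))) (Icc 0 (r / 2)) 0 := by
    intro j t ht
    have hc : Continuous fun b : ℝ ↦ spt v P.gr.ℓ j (P.sgn hv hvb j) (b, t) :=
      (continuous_spt hℓ j _).comp (continuous_id.prodMk continuous_const)
    have hmt : MapsTo (fun b : ℝ ↦ spt v P.gr.ℓ j (P.sgn hv hvb j) (b, t)) (Icc 0 (r / 2)) (closedBall v r) :=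
      fun b hb ↦ hmem j b hb t ht
    exact ContinuousWithinAt.comp (f := fun b : ℝ ↦ spt v P.gr.ℓ j (P.sgn hv hvb j) (b, t)) (x := 0)
      (hcont _ (hmem j 0 ⟨le_rfl, by linarith⟩ t ht)) hc.continuousWithinAt hmt
  have hδ : ∀ j, ∃ δ > (0 : ℝ), ∀ b ∈ Icc 0 (r / 2), b < δ →
      ρ ≤ P.Hv hv hvb (spt v P.gr.ℓ j (P.sgn hv hvb j) (b, u₀)) ∧
        P.Hv hv hvb (spt v P.gr.ℓ j (P.sgn hv hvb j) (b, -u₀)) ≤ -ρ := by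
    intro j
    have htop0 : 2 * ρ ≤ P.Hv hv hvb (spt v P.gr.ℓ j (P.sgn hv hvb j) (0, u₀)) := (hρA j).trans (min_le_left _ _)
    have hbot0 : P.Hv hv hvb (spt v P.gr.ℓ j (P.sgn hv hvb j) (0, -u₀)) ≤ -(2 * ρ) := by
      have := (hρA j).trans (min_le_right _ _); linarith
    have h₁ := Metric.continuousWithinAt_iff.1 (key j u₀ huI) ρ hρpos
    have h₂ := Metric.continuousWithinAt_iff.1 (key j (-u₀) hnuI) ρ hρpos
    obtain ⟨δ₁, hδ₁, hb₁⟩ := h₁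
    obtain ⟨δ₂, hδ₂, hb₂⟩ := h₂
    refine ⟨min δ₁ δ₂, lt_min hδ₁ hδ₂, fun b hb hbδ ↦ ⟨?_, ?_⟩⟩
    · have h := hb₁ hb (by rw [dist_zero_right, Real.norm_of_nonneg hb.1]; exact hbδ.trans_le (min_le_left _ _))
      rw [Real.dist_eq, abs_lt] at h
      linarith
    · have h := hb₂ hb (by rw [dist_zero_right, Real.norm_of_nonneg hb.1]; exact hbδ.trans_le (min_le_right _ _))
      rw [Real.dist_eq, abs_lt] at h
      linarith
  choose δ hδpos hδspec using hδ
  obtain ⟨j₁, -, hj₁⟩ := Finset.exists_min_image Finset.univ δ Finset.univ_nonempty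
  set ρb := min (δ j₁ / 2) (r / 2) with hρb
  have hρbpos : 0 < ρb := lt_min (by linarith [hδpos j₁]) (by linarith)
  refine ⟨⟨r, u₀, ρ, ρb, hr0, hrℓ, hrgap, hcorr, hu₀pos, by rw [hu₀]; linarith, hρpos, hρbpos, min_le_right _ _,
    fun j b hb ↦ ?_, fun j b hb ↦ ?_⟩⟩
  · have hb' : b ∈ Icc 0 (r / 2) := ⟨hb.1, hb.2.trans (min_le_right _ _)⟩
    have hbδ : b < δ j := (hb.2.trans_lt ((min_le_left _ _).trans_lt (by linarith [hδpos j₁]))).trans_le (hj₁ j (Finset.mem_univ j))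
    exact (hδspec j b hb' hbδ).1
  · have hb' : b ∈ Icc 0 (r / 2) := ⟨hb.1, hb.2.trans (min_le_right _ _)⟩
    have hbδ : b < δ j := (hb.2.trans_lt ((min_le_left _ _).trans_lt (by linarith [hδpos j₁]))).trans_le (hj₁ j (Finset.mem_univ j))
    exact (hδspec j b hb' hbδ).2

/-- **The chosen constants.** [folklore] -/
def vtx : P.VtxConst hv hvb := Classical.choice (P.exists_vtxConst hv hvb ho)

/-- The constants, abbreviated (local notation). -/
local notation "𝔠" => P.vtx hv hvb ho

/-! ## The sectors and the coordinates -/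

/-- The plane sector `j`: the broken-ray parametrisation of `[0, ρ_b] × [-u₀, u₀]`. [folklore] -/
def vK (j : ZMod 4) : Set (ℝ × ℝ) :=
  spt v P.gr.ℓ j (P.sgn hv hvb j) '' (Icc 0 (P.vtx hv hvb ho).ρb ×ˢ Icc (-(P.vtx hv hvb ho).u₀) (P.vtx hv hvb ho).u₀)

/-- The scaled `b`-coordinate. [folklore] -/
def vb (j : ZMod 4) (z : ℂ) : ℝ := (P.vtx hv hvb ho).ρ / (P.vtx hv hvb ho).ρb * bco v P.gr.ℓ j (toR z)

/-- The common height, on the complex plane. [folklore] -/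
def vH (z : ℂ) : ℝ := P.Hv hv hvb (toR z)

/-- **The sector `j` of the vertex star.** [folklore] -/
def vS (j : ZMod 4) : Set ℂ :=
  {z | toR z ∈ P.vK hv hvb ho j ∧ P.vb hv hvb ho j z ∈ Icc 0 (P.vtx hv hvb ho).ρ ∧
    P.vH hv hvb z ∈ Icc (-(P.vtx hv hvb ho).ρ) (P.vtx hv hvb ho).ρ}

section Basic

variable {P hv hvb ho}

/-- Parameters of a point of the plane sector. [folklore] -/
theorem exists_eq_spt_of_mem_vK {j : ZMod 4} {w : ℝ × ℝ} (hw : w ∈ P.vK hv hvb ho j) :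
    ∃ b ∈ Icc 0 (P.vtx hv hvb ho).ρb, ∃ t ∈ Icc (-(P.vtx hv hvb ho).u₀) (P.vtx hv hvb ho).u₀,
      spt v P.gr.ℓ j (P.sgn hv hvb j) (b, t) = w := by
  obtain ⟨⟨b, t⟩, ⟨hb, ht⟩, rfl⟩ := hw
  exact ⟨b, hb, t, ht, rfl⟩

variable (P hv hvb ho)

/-- `u₀ < ℓ`. [folklore] -/
theorem u₀_lt : (𝔠).u₀ < P.gr.ℓ := by
  have := (𝔠).u₀_lt; have := (𝔠).r_le; have := (𝔠).r_pos; linarith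

/-- `u₀ + ρ_b < r`. [folklore] -/
theorem u₀_add_ρb_lt : (𝔠).u₀ + (𝔠).ρb < (𝔠).r := by linarith [(𝔠).u₀_lt, (𝔠).ρb_le]

/-- Points of the plane sectors are at distance `< r` from `v`. [folklore] -/
theorem dist_lt_of_mem_vK {j : ZMod 4} {w : ℝ × ℝ} (hw : w ∈ P.vK hv hvb ho j) : dist w v < (𝔠).r := by
  obtain ⟨b, hb, t, ht, rfl⟩ := exists_eq_spt_of_mem_vK hw
  have hℓb : b ∈ Icc 0 P.gr.ℓ := ⟨hb.1, by linarith [hb.2, (𝔠).ρb_le, (𝔠).r_le, (𝔠).r_pos]⟩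
  have h := dist_spt_le (v := v) P.gr.hℓ j (P.isSg_sgn hv hvb j) (u := t) hℓb
  have : |t| ≤ (𝔠).u₀ := abs_le.2 ⟨ht.1, ht.2⟩
  linarith [hb.2, P.u₀_add_ρb_lt hv hvb ho]

/-- `ρb ≤ ℓ`. [folklore] -/
theorem ρb_le_ℓ : (𝔠).ρb ≤ P.gr.ℓ := by
  have := (𝔠).ρb_le; have := (𝔠).r_le; have := (𝔠).r_pos; linarith

/-- The plane sectors lie in the closed ball of the vertex radius. [folklore] -/
theorem vK_subset_closedBall (j : ZMod 4) : P.vK hv hvb ho j ⊆ closedBall v (𝔠).r := fun _ hw ↦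
  mem_closedBall.2 (P.dist_lt_of_mem_vK hv hvb ho hw).le

/-- The plane sectors are compact. [folklore] -/
theorem isCompact_vK (j : ZMod 4) : IsCompact (P.vK hv hvb ho j) :=
  (isCompact_Icc.prod isCompact_Icc).image (continuous_spt P.gr.hℓ j _)

/-- The `b`-coordinate of a parametrised point. [folklore] -/
theorem vb_spt (j : ZMod 4) (b : ℝ) {t : ℝ} (ht : t ∈ Icc (-(𝔠).u₀) (𝔠).u₀) :
    P.vb hv hvb ho j (toC (spt v P.gr.ℓ j (P.sgn hv hvb j) (b, t))) = (𝔠).ρ / (𝔠).ρb * b := by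
  have hu : |t| < P.gr.ℓ := (abs_le.2 ⟨ht.1, ht.2⟩).trans_lt (P.u₀_lt hv hvb ho)
  rw [vb, toR_toC, bco_spt P.gr.hℓ j (P.isSg_sgn hv hvb j) (by exact hu)]

/-- The height of a parametrised point. [folklore] -/
theorem vH_toC (w : ℝ × ℝ) : P.vH hv hvb (toC w) = P.Hv hv hvb w := rfl

/-- **Continuity of the height on the plane sector.** [folklore] -/
theorem continuousOn_vH (j : ZMod 4) : ContinuousOn (P.vH hv hvb) (P.vS hv hvb ho j) := by
  have hc := P.continuousOn_Hv hv hvb (𝔠).r_le (𝔠).r_gap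
  exact (hc.comp continuous_toR.continuousOn fun z hz ↦ P.vK_subset_closedBall hv hvb ho j hz.1)

/-- **Continuity of the `b`-coordinate on the plane sector.** [folklore] -/
theorem continuousOn_vb (j : ZMod 4) : ContinuousOn (P.vb hv hvb ho j) (P.vS hv hvb ho j) := by
  refine (continuousOn_const.mul ((continuousOn_bco (v := v) (ℓ := P.gr.ℓ) j).comp continuous_toR.continuousOn
    fun z hz ↦ ?_))
  obtain ⟨b, hb, t, ht, hw⟩ := exists_eq_spt_of_mem_vK hz.1
  show |(stdc v j (toR z)).2| < P.gr.ℓ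
  rw [← hw, stdc_spt, stdPt]
  simp only [(P.isSg_sgn hv hvb j).abs_mul]
  exact (abs_le.2 ⟨ht.1, ht.2⟩).trans_lt (P.u₀_lt hv hvb ho)

/-- The sectors are compact. [folklore] -/
theorem isCompact_vS (j : ZMod 4) : IsCompact (P.vS hv hvb ho j) := by
  -- `vS j = K' ∩ (vb, vH)⁻¹' rect` with `K' = toR⁻¹' vK` compact
  have hK : IsCompact (toR ⁻¹' P.vK hv hvb ho j : Set ℂ) := by
    have : (toR ⁻¹' P.vK hv hvb ho j : Set ℂ) = toC '' P.vK hv hvb ho j := by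
      ext z; constructor
      · intro hz; exact ⟨toR z, hz, rfl⟩
      · rintro ⟨w, hw, rfl⟩; exact hw
    rw [this]; exact (P.isCompact_vK hv hvb ho j).image continuous_toC
  have hcl : IsClosed (P.vS hv hvb ho j) := by
    have hcont : ContinuousOn (fun z ↦ (P.vb hv hvb ho j z, P.vH hv hvb z)) (toR ⁻¹' P.vK hv hvb ho j) := by
      -- the two coordinates are continuous on the bigger set by the same proofs
      refine ContinuousOn.prodMk ?_ ?_
      · refine (continuousOn_const.mul ((continuousOn_bco (v := v) (ℓ := P.gr.ℓ) j).comp continuous_toR.continuousOn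
          fun z hz ↦ ?_))
        obtain ⟨b, hb, t, ht, hw⟩ := exists_eq_spt_of_mem_vK hz
        show |(stdc v j (toR z)).2| < P.gr.ℓ
        rw [← hw, stdc_spt, stdPt]
        simp only [(P.isSg_sgn hv hvb j).abs_mul]
        exact (abs_le.2 ⟨ht.1, ht.2⟩).trans_lt (P.u₀_lt hv hvb ho)
      · exact (P.continuousOn_Hv hv hvb (𝔠).r_le (𝔠).r_gap).comp continuous_toR.continuousOn
          fun z hz ↦ P.vK_subset_closedBall hv hvb ho j hz
    have h := hcont.preimage_isClosed_of_isClosed hK.isClosed (isClosed_Icc.prod isClosed_Icc :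
      IsClosed (Icc 0 (𝔠).ρ ×ˢ Icc (-(𝔠).ρ) (𝔠).ρ))
    convert h using 1
    ext z
    simp only [vS, mem_setOf_eq, mem_inter_iff, mem_preimage, mem_prod]
  exact hK.of_isClosed_subset hcl fun z hz ↦ hz.1

/-- `v` is a point of every sector. [folklore] -/
theorem toC_mem_vS (j : ZMod 4) : toC v ∈ P.vS hv hvb ho j := by
  have hb : (0 : ℝ) ∈ Icc 0 (𝔠).ρb := ⟨le_rfl, (𝔠).ρb_pos.le⟩
  have ht : (0 : ℝ) ∈ Icc (-(𝔠).u₀) (𝔠).u₀ := ⟨by linarith [(𝔠).u₀_pos], (𝔠).u₀_pos.le⟩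
  have hv0 : spt v P.gr.ℓ j (P.sgn hv hvb j) (0, 0) = v := spt_zero j _
  refine ⟨⟨(0, 0), ⟨hb, ht⟩, hv0⟩, ?_, ?_⟩
  · have h := P.vb_spt hv hvb ho j 0 ht
    rw [hv0, mul_zero] at h
    rw [h]; exact ⟨le_rfl, (𝔠).ρ_pos.le⟩
  · rw [show P.vH hv hvb (toC v) = 0 from P.Hv_self hv hvb]
    exact ⟨by linarith [(𝔠).ρ_pos], (𝔠).ρ_pos.le⟩

/-- `vH (toC v) = 0`. [folklore] -/
theorem vH_v : P.vH hv hvb (toC v) = 0 := P.Hv_self hv hvb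

/-- `vb j (toC v) = 0`. [folklore] -/
theorem vb_v (j : ZMod 4) : P.vb hv hvb ho j (toC v) = 0 := by
  have ht : (0 : ℝ) ∈ Icc (-(𝔠).u₀) (𝔠).u₀ := ⟨by linarith [(𝔠).u₀_pos], (𝔠).u₀_pos.le⟩
  have h := P.vb_spt hv hvb ho j 0 ht
  rwa [show ((0 : ℝ), (0 : ℝ)) = (0 : ℝ × ℝ) from rfl, spt_zero, mul_zero] at h

variable {P hv hvb ho}

/-- **Parameters of a point of the sector**, with the value of the `b`-coordinate. [folklore] -/
theorem exists_param {j : ZMod 4} {z : ℂ} (hz : z ∈ P.vS hv hvb ho j) :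
    ∃ b ∈ Icc 0 (𝔠).ρb, ∃ t ∈ Icc (-(𝔠).u₀) (𝔠).u₀,
      spt v P.gr.ℓ j (P.sgn hv hvb j) (b, t) = toR z ∧ P.vb hv hvb ho j z = (𝔠).ρ / (𝔠).ρb * b := by
  obtain ⟨b, hb, t, ht, h⟩ := exists_eq_spt_of_mem_vK hz.1
  refine ⟨b, hb, t, ht, h, ?_⟩
  have := P.vb_spt hv hvb ho j b ht
  rwa [h, toC_toR] at this

end Basic

/-! ## Cone geometry of the plane sectors -/

section Geometry

/-- Standard coordinates of the next sector: a quarter turn backwards. [folklore] -/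
theorem stdc_add_one (j : ZMod 4) (w : ℝ × ℝ) :
    stdc v (j + 1) w = ((stdc v j w).2, -(stdc v j w).1) := by
  simp only [stdc]
  rw [neg_add_rev, Rz_add, Module.End.mul_apply, show (-1 : ZMod 4) = 3 from rfl, Rz_three]

/-- Standard coordinates of the opposite sector: a half turn. [folklore] -/
theorem stdc_add_two (j : ZMod 4) (w : ℝ × ℝ) :
    stdc v (j + 2) w = (-(stdc v j w).1, -(stdc v j w).2) := by
  simp only [stdc]
  rw [neg_add_rev, Rz_add, Module.End.mul_apply, show (-2 : ZMod 4) = 2 from rfl, Rz_two]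

/-- Only `v` has vanishing standard coordinates. [folklore] -/
theorem eq_of_stdc_eq_zero {j : ZMod 4} {w : ℝ × ℝ} (h : stdc v j w = 0) : w = v := by
  have : Rz j (stdc v j w) = w - v := by rw [stdc, Rz_Rz_neg]
  rw [h, map_zero] at this
  exact (sub_eq_zero.1 this.symm)

/-- **Every direction lies in one of the four cones** `|x₂| ≤ x₁` of the rotated standard
coordinates. [folklore] -/
theorem exists_cone (d : ℝ × ℝ) : ∃ j : ZMod 4, |(Rz (-j) d).2| ≤ (Rz (-j) d).1 := by
  rcases le_or_gt |d.2| d.1 with h | h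
  · exact ⟨0, by rw [neg_zero, Rz_zero]; exact h⟩
  rcases le_or_gt |d.1| d.2 with h' | h'
  · refine ⟨1, ?_⟩
    rw [show (-1 : ZMod 4) = 3 from rfl, Rz_three]
    simpa using h'
  rcases le_or_gt |d.2| (-d.1) with h'' | h''
  · refine ⟨2, ?_⟩
    rw [show (-2 : ZMod 4) = 2 from rfl, Rz_two]
    simpa using h''
  · refine ⟨3, ?_⟩
    rw [show (-3 : ZMod 4) = 1 from rfl, Rz_one]
    simp only
    have h1 : |d.1| < |d.2| := abs_lt.2 ⟨by linarith, h⟩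
    have h2 : d.2 < 0 := by
      by_contra hc
      push Not at hc
      rw [abs_of_nonneg hc] at h1
      linarith
    rw [abs_of_neg h2] at h1
    exact h1.le

variable {P hv hvb ho}

/-- **The cone condition**: in the standard coordinates of the sector `j`, a point of the plane
sector satisfies `|x₂| ≤ x₁` and `|x₂| ≤ u₀`. [folklore] -/
theorem abs_stdc_snd_le {j : ZMod 4} {w : ℝ × ℝ} (hw : w ∈ P.vK hv hvb ho j) :
    |(stdc v j w).2| ≤ (stdc v j w).1 ∧ |(stdc v j w).2| ≤ (𝔠).u₀ := by
  obtain ⟨b, hb, t, ht, rfl⟩ := exists_eq_spt_of_mem_vK hw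
  simp only [stdc_spt, stdPt, (P.isSg_sgn hv hvb j).abs_mul]
  have ht' : |t| ≤ (𝔠).u₀ := abs_le.2 ⟨ht.1, ht.2⟩
  have hℓ := P.gr.hℓ
  refine ⟨?_, ht'⟩
  have h1 : |t| * (P.gr.ℓ - b) / P.gr.ℓ = |t| - |t| * b / P.gr.ℓ := by field_simp
  rw [h1]
  have h2 : |t| * b / P.gr.ℓ ≤ b := by
    rw [div_le_iff₀ hℓ]
    have : |t| ≤ P.gr.ℓ := ht'.trans (P.u₀_lt hv hvb ho).le
    nlinarith [hb.1, abs_nonneg t]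
  linarith

/-- If moreover `x₁ ≤ |x₂|`, the point is on the axis: its `b`-parameter vanishes. [folklore] -/
theorem fst_eq_zero_of_stdc_fst_le {j : ZMod 4} {b t : ℝ} (hb : b ∈ Icc 0 (𝔠).ρb)
    (ht : t ∈ Icc (-(𝔠).u₀) (𝔠).u₀)
    (h : (stdc v j (spt v P.gr.ℓ j (P.sgn hv hvb j) (b, t))).1 ≤
      |(stdc v j (spt v P.gr.ℓ j (P.sgn hv hvb j) (b, t))).2|) :
    b = 0 := by
  simp only [stdc_spt, stdPt, (P.isSg_sgn hv hvb j).abs_mul] at h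
  have hℓ := P.gr.hℓ
  have ht' : |t| < P.gr.ℓ := (abs_le.2 ⟨ht.1, ht.2⟩).trans_lt (P.u₀_lt hv hvb ho)
  have h1 : |t| * (P.gr.ℓ - b) / P.gr.ℓ = |t| - |t| * b / P.gr.ℓ := by field_simp
  rw [h1] at h
  have h3 : b * P.gr.ℓ ≤ |t| * b := by
    have h4 : b ≤ |t| * b / P.gr.ℓ := by linarith
    rwa [le_div_iff₀ hℓ] at h4
  rcases hb.1.eq_or_lt with h0 | h0
  · exact h0.symm
  · exfalso
    have : b * |t| < b * P.gr.ℓ := mul_lt_mul_of_pos_left ht' h0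
    nlinarith

omit [NormedSpace ℝ B] in
/-- The ordinate of a parametrised point in standard coordinates. [folklore] -/
theorem stdc_spt_snd (j : ZMod 4) (b t : ℝ) :
    (stdc v j (spt v P.gr.ℓ j (P.sgn hv hvb j) (b, t))).2 = P.sgn hv hvb j * t := by
  rw [stdc_spt]; rfl

/-- **A point of two consecutive plane sectors is on the shared half axis** (seen from the first
sector). [folklore] -/
theorem fst_eq_zero_of_mem_vK_succ {j : ZMod 4} {b t : ℝ} (hb : b ∈ Icc 0 (𝔠).ρb)
    (ht : t ∈ Icc (-(𝔠).u₀) (𝔠).u₀)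
    (h : spt v P.gr.ℓ j (P.sgn hv hvb j) (b, t) ∈ P.vK hv hvb ho (j + 1)) :
    b = 0 ∧ 0 ≤ P.sgn hv hvb j * t := by
  have hwK : spt v P.gr.ℓ j (P.sgn hv hvb j) (b, t) ∈ P.vK hv hvb ho j := ⟨(b, t), ⟨hb, ht⟩, rfl⟩
  have h1 := abs_stdc_snd_le hwK
  have h2 := abs_stdc_snd_le h
  rw [stdc_add_one] at h2
  simp only [abs_neg] at h2
  have hx12 : (stdc v j (spt v P.gr.ℓ j (P.sgn hv hvb j) (b, t))).1 ≤
      |(stdc v j (spt v P.gr.ℓ j (P.sgn hv hvb j) (b, t))).2| :=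
    calc (stdc v j (spt v P.gr.ℓ j (P.sgn hv hvb j) (b, t))).1
        ≤ |(stdc v j (spt v P.gr.ℓ j (P.sgn hv hvb j) (b, t))).1| := le_abs_self _
      _ ≤ (stdc v j (spt v P.gr.ℓ j (P.sgn hv hvb j) (b, t))).2 := h2.1
      _ ≤ |(stdc v j (spt v P.gr.ℓ j (P.sgn hv hvb j) (b, t))).2| := le_abs_self _
  refine ⟨fst_eq_zero_of_stdc_fst_le hb ht hx12, ?_⟩
  have h3 := stdc_spt_snd (P := P) (hv := hv) (hvb := hvb) j b t
  linarith [h2.1, abs_nonneg (stdc v j (spt v P.gr.ℓ j (P.sgn hv hvb j) (b, t))).1]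

/-- **A point of two consecutive plane sectors is on the shared half axis** (seen from the
second sector). [folklore] -/
theorem fst_eq_zero_of_mem_vK_pred {j : ZMod 4} {b t : ℝ} (hb : b ∈ Icc 0 (𝔠).ρb)
    (ht : t ∈ Icc (-(𝔠).u₀) (𝔠).u₀)
    (h : spt v P.gr.ℓ (j + 1) (P.sgn hv hvb (j + 1)) (b, t) ∈ P.vK hv hvb ho j) :
    b = 0 ∧ P.sgn hv hvb (j + 1) * t ≤ 0 := by
  have hwK : spt v P.gr.ℓ (j + 1) (P.sgn hv hvb (j + 1)) (b, t) ∈ P.vK hv hvb ho (j + 1) :=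
    ⟨(b, t), ⟨hb, ht⟩, rfl⟩
  have h1 := abs_stdc_snd_le hwK
  have h2 := abs_stdc_snd_le h
  set w := spt v P.gr.ℓ (j + 1) (P.sgn hv hvb (j + 1)) (b, t) with hw
  have key : (stdc v (j + 1) w).1 ≤ |(stdc v (j + 1) w).2| := by
    rw [stdc_add_one]
    simp only [abs_neg]
    calc (stdc v j w).2 ≤ |(stdc v j w).2| := le_abs_self _
      _ ≤ (stdc v j w).1 := h2.1
      _ ≤ |(stdc v j w).1| := le_abs_self _
  refine ⟨fst_eq_zero_of_stdc_fst_le hb ht key, ?_⟩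
  have h3 : (stdc v (j + 1) w).2 = P.sgn hv hvb (j + 1) * t := stdc_spt_snd (j + 1) b t
  have h4 : (stdc v (j + 1) w).2 = -(stdc v j w).1 := by rw [stdc_add_one]
  linarith [h2.1, abs_nonneg (stdc v j w).2]

variable (P hv hvb ho)

/-! ## Signs of the height on the axes -/

/-- The height on the axis of the sector `j` is positive exactly at positive ordinates.
[folklore] -/
theorem Hv_axis_pos_iff (j : ZMod 4) {t : ℝ} (ht : t ∈ Icc (-(𝔠).u₀) (𝔠).u₀) :
    0 < P.Hv hv hvb (spt v P.gr.ℓ j (P.sgn hv hvb j) (0, t)) ↔ 0 < t := by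
  have hsign := P.Hv_spt_axis_sign hv hvb (𝔠).corr j ⟨(𝔠).u₀_pos.le, P.u₀_lt hv hvb ho⟩
    (by linarith [P.u₀_add_ρb_lt hv hvb ho, (𝔠).ρb_pos] : (𝔠).u₀ ≤ (𝔠).r) ht
  rcases lt_trichotomy t 0 with h0 | rfl | h0
  · have := hsign.2 h0
    constructor <;> intro <;> linarith
  · rw [show ((0 : ℝ), (0 : ℝ)) = (0 : ℝ × ℝ) from rfl, spt_zero, Hv_self]
  · have := hsign.1 h0
    exact ⟨fun _ ↦ h0, fun _ ↦ this⟩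

/-- The height on the axis of the sector `j` is negative exactly at negative ordinates.
[folklore] -/
theorem Hv_axis_neg_iff (j : ZMod 4) {t : ℝ} (ht : t ∈ Icc (-(𝔠).u₀) (𝔠).u₀) :
    P.Hv hv hvb (spt v P.gr.ℓ j (P.sgn hv hvb j) (0, t)) < 0 ↔ t < 0 := by
  have hsign := P.Hv_spt_axis_sign hv hvb (𝔠).corr j ⟨(𝔠).u₀_pos.le, P.u₀_lt hv hvb ho⟩
    (by linarith [P.u₀_add_ρb_lt hv hvb ho, (𝔠).ρb_pos] : (𝔠).u₀ ≤ (𝔠).r) ht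
  rcases lt_trichotomy t 0 with h0 | rfl | h0
  · have := hsign.2 h0
    exact ⟨fun _ ↦ h0, fun _ ↦ this⟩
  · rw [show ((0 : ℝ), (0 : ℝ)) = (0 : ℝ × ℝ) from rfl, spt_zero, Hv_self]
  · have := hsign.1 h0
    constructor <;> intro <;> linarith

/-- `0 ≤ s · Hv` on the axis iff `0 ≤ s · t`, for a sign `s`. [folklore] -/
theorem sgn_mul_Hv_axis_nonneg_iff (j : ZMod 4) {s : ℝ} (hs : IsSg s) {t : ℝ}
    (ht : t ∈ Icc (-(𝔠).u₀) (𝔠).u₀) :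
    0 ≤ s * P.Hv hv hvb (spt v P.gr.ℓ j (P.sgn hv hvb j) (0, t)) ↔ 0 ≤ s * t := by
  rcases hs with rfl | rfl
  · rw [one_mul, one_mul, ← not_lt, ← not_lt, P.Hv_axis_neg_iff hv hvb ho j ht]
  · rw [neg_one_mul, neg_one_mul, neg_nonneg, neg_nonneg, ← not_lt, ← not_lt, P.Hv_axis_pos_iff hv hvb ho j ht]

omit [NormedSpace ℝ B] in
/-- The shared half axis, parametrised from the sector `j + 1`. [folklore] -/
theorem spt_axis_succ' (j : ZMod 4) (t : ℝ) (h : 0 ≤ P.sgn hv hvb j * t) :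
    spt v P.gr.ℓ (j + 1) (P.sgn hv hvb (j + 1)) (0, t) = spt v P.gr.ℓ j (P.sgn hv hvb j) (0, t) :=
  spt_axis_succ P.gr.hℓ.ne' j h (by rw [P.sgn_add_one hv hvb j]; ring)

/-- Axis points with `|Hv| ≤ ρ` are in the sector. [folklore] -/
theorem toC_spt_axis_mem {j : ZMod 4} {t : ℝ} (ht : t ∈ Icc (-(𝔠).u₀) (𝔠).u₀)
    (hH : P.Hv hv hvb (spt v P.gr.ℓ j (P.sgn hv hvb j) (0, t)) ∈ Icc (-(𝔠).ρ) (𝔠).ρ) :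
    toC (spt v P.gr.ℓ j (P.sgn hv hvb j) (0, t)) ∈ P.vS hv hvb ho j := by
  have hb : (0 : ℝ) ∈ Icc 0 (𝔠).ρb := ⟨le_rfl, (𝔠).ρb_pos.le⟩
  refine ⟨⟨(0, t), ⟨hb, ht⟩, rfl⟩, ?_, hH⟩
  rw [P.vb_spt hv hvb ho j 0 ht, mul_zero]
  exact ⟨le_rfl, (𝔠).ρ_pos.le⟩

/-! ## The coordinates: injectivity and image -/

/-- **Strict monotonicity of the height along the fibres `b = const` of the sector.**
[folklore] -/
theorem strictMonoOn_Hv_spt' (j : ZMod 4) {b : ℝ} (hb : b ∈ Icc 0 (𝔠).ρb) :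
    StrictMonoOn (fun t ↦ P.Hv hv hvb (spt v P.gr.ℓ j (P.sgn hv hvb j) (b, t))) (Icc (-(𝔠).u₀) (𝔠).u₀) :=
  P.strictMonoOn_Hv_spt hv hvb (𝔠).corr j ⟨hb.1, hb.2.trans (P.ρb_le_ℓ hv hvb ho)⟩
    ⟨(𝔠).u₀_pos.le, P.u₀_lt hv hvb ho⟩ (by linarith [hb.2, P.u₀_add_ρb_lt hv hvb ho])

/-- **The coordinates are injective on the sector.** [folklore] -/
theorem injOn_chart (j : ZMod 4) : InjOn (fun z ↦ (P.vb hv hvb ho j z, P.vH hv hvb z)) (P.vS hv hvb ho j) := by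
  intro z hz z' hz' h
  simp only [Prod.mk.injEq] at h
  obtain ⟨b, hb, t, ht, hzt, hbz⟩ := exists_param hz
  obtain ⟨b', hb', t', ht', hzt', hbz'⟩ := exists_param hz'
  have hκ : (𝔠).ρ / (𝔠).ρb ≠ 0 := (div_pos (𝔠).ρ_pos (𝔠).ρb_pos).ne'
  have hbb : b = b' := by
    have := h.1
    rw [hbz, hbz'] at this
    exact mul_left_cancel₀ hκ this
  subst hbb
  have htt : t = t' := by
    have hH : P.Hv hv hvb (spt v P.gr.ℓ j (P.sgn hv hvb j) (b, t)) =
        P.Hv hv hvb (spt v P.gr.ℓ j (P.sgn hv hvb j) (b, t')) := by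
      rw [hzt, hzt']; exact h.2
    exact (P.strictMonoOn_Hv_spt' hv hvb ho j hb).injOn ht ht' hH
  subst htt
  apply toR_injective
  rw [← hzt, ← hzt']

/-- Continuity of the height along the fibres. [folklore] -/
theorem continuousOn_Hv_spt (j : ZMod 4) {b : ℝ} (hb : b ∈ Icc 0 (𝔠).ρb) :
    ContinuousOn (fun t ↦ P.Hv hv hvb (spt v P.gr.ℓ j (P.sgn hv hvb j) (b, t))) (Icc (-(𝔠).u₀) (𝔠).u₀) := by
  have hc : Continuous fun t : ℝ ↦ spt v P.gr.ℓ j (P.sgn hv hvb j) (b, t) :=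
    (continuous_spt P.gr.hℓ j _).comp (continuous_const.prodMk continuous_id)
  refine (P.continuousOn_Hv hv hvb (𝔠).r_le (𝔠).r_gap).comp hc.continuousOn fun t ht ↦ ?_
  exact P.vK_subset_closedBall hv hvb ho j ⟨(b, t), ⟨hb, ht⟩, rfl⟩

/-- **The coordinates map the sector onto the model half square** (intermediate value theorem
along the fibres). [folklore] -/
theorem image_chart (j : ZMod 4) :
    (fun z ↦ (P.vb hv hvb ho j z, P.vH hv hvb z)) '' P.vS hv hvb ho j = Icc 0 (𝔠).ρ ×ˢ Icc (-(𝔠).ρ) (𝔠).ρ := by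
  refine Subset.antisymm ?_ ?_
  · rintro _ ⟨z, hz, rfl⟩
    exact ⟨hz.2.1, hz.2.2⟩
  · rintro ⟨x, y⟩ ⟨hx, hy⟩
    have hρ := (𝔠).ρ_pos
    have hρb := (𝔠).ρb_pos
    set b := (𝔠).ρb / (𝔠).ρ * x with hb
    have hbI : b ∈ Icc 0 (𝔠).ρb := by
      refine ⟨by rw [hb]; exact mul_nonneg (div_pos hρb hρ).le hx.1, ?_⟩
      rw [hb]
      calc (𝔠).ρb / (𝔠).ρ * x ≤ (𝔠).ρb / (𝔠).ρ * (𝔠).ρ := mul_le_mul_of_nonneg_left hx.2 (div_pos hρb hρ).le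
        _ = (𝔠).ρb := div_mul_cancel₀ _ hρ.ne'
    have hκb : (𝔠).ρ / (𝔠).ρb * b = x := by rw [hb]; field_simp
    have hu : -(𝔠).u₀ ≤ (𝔠).u₀ := by linarith [(𝔠).u₀_pos]
    have hivt := intermediate_value_Icc hu (P.continuousOn_Hv_spt hv hvb ho j hbI)
    have hy' : y ∈ Icc (P.Hv hv hvb (spt v P.gr.ℓ j (P.sgn hv hvb j) (b, -(𝔠).u₀)))
        (P.Hv hv hvb (spt v P.gr.ℓ j (P.sgn hv hvb j) (b, (𝔠).u₀))) :=
      ⟨((𝔠).bot j b hbI).trans hy.1, hy.2.trans ((𝔠).top j b hbI)⟩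
    obtain ⟨t, ht, hty⟩ := hivt hy'
    simp only at hty
    refine ⟨toC (spt v P.gr.ℓ j (P.sgn hv hvb j) (b, t)), ⟨⟨(b, t), ⟨hbI, ht⟩, rfl⟩, ?_, ?_⟩, ?_⟩
    · rw [P.vb_spt hv hvb ho j b ht, hκb]; exact hx
    · rw [vH_toC, hty]; exact hy
    · simp only [Prod.mk.injEq]
      exact ⟨by rw [P.vb_spt hv hvb ho j b ht, hκb], by rw [vH_toC, hty]⟩

/-! ## The star is a neighbourhood of `v` -/

/-- **The four sectors cover a neighbourhood of `v`.** [folklore] -/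
theorem iUnion_vS_mem_nhds : (⋃ j, P.vS hv hvb ho j) ∈ 𝓝 (toC v) := by
  have hℓ := P.gr.hℓ
  have hρ := (𝔠).ρ_pos
  have hρb := (𝔠).ρb_pos
  have hHv : ContinuousAt (P.Hv hv hvb) v :=
    ((P.continuousOn_Hv hv hvb (𝔠).r_le (𝔠).r_gap).continuousWithinAt
      (mem_closedBall_self (𝔠).r_pos.le)).continuousAt (closedBall_mem_nhds v (𝔠).r_pos)
  obtain ⟨δ₁, hδ₁, hHδ⟩ := Metric.continuousAt_iff.1 hHv (𝔠).ρ hρ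
  set δ := min (min ((𝔠).ρb / 2) (𝔠).u₀) (min δ₁ (P.gr.ℓ / 2)) with hδ
  have hδpos : 0 < δ := lt_min (lt_min (by linarith) (𝔠).u₀_pos) (lt_min hδ₁ (by linarith))
  have hδρb : δ ≤ (𝔠).ρb / 2 := (min_le_left _ _).trans (min_le_left _ _)
  have hδu : δ ≤ (𝔠).u₀ := (min_le_left _ _).trans (min_le_right _ _)
  have hδ₁' : δ ≤ δ₁ := (min_le_right _ _).trans (min_le_left _ _)
  have hδℓ : δ ≤ P.gr.ℓ / 2 := (min_le_right _ _).trans (min_le_right _ _)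
  rw [Metric.mem_nhds_iff]
  refine ⟨δ, hδpos, fun z hz ↦ ?_⟩
  rw [mem_ball] at hz
  have hwv : dist (toR z) v < δ := by
    have h := dist_toR_le z (toC v)
    rw [toR_toC] at h
    exact h.trans_lt hz
  obtain ⟨j, hj⟩ := exists_cone (toR z - v)
  -- `x` = standard coordinates of `toR z` in the sector `j`
  have hxd : stdc v j (toR z) = Rz (-j) (toR z - v) := rfl
  have hnx : ‖stdc v j (toR z)‖ < δ := by rw [hxd, norm_Rz, ← dist_eq_norm]; exact hwv
  have hx1 : |(stdc v j (toR z)).1| < δ := (norm_fst_le _).trans_lt hnx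
  have hx2 : |(stdc v j (toR z)).2| < δ := (norm_snd_le _).trans_lt hnx
  have hcone : |(stdc v j (toR z)).2| ≤ (stdc v j (toR z)).1 := by rw [hxd]; exact hj
  have hx2ℓ : |(stdc v j (toR z)).2| < P.gr.ℓ := by linarith
  have hs : IsSg (P.sgn hv hvb j) := P.isSg_sgn hv hvb j
  have hrepr : spt v P.gr.ℓ j (P.sgn hv hvb j) (bco v P.gr.ℓ j (toR z), P.sgn hv hvb j * uco v j (toR z)) = toR z :=
    spt_bco hℓ j hs hx2ℓ
  -- bounds on the parameters
  have hbval : bco v P.gr.ℓ j (toR z) =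
      P.gr.ℓ * ((stdc v j (toR z)).1 - |(stdc v j (toR z)).2|) / (P.gr.ℓ - |(stdc v j (toR z)).2|) := rfl
  have hb0 : 0 ≤ bco v P.gr.ℓ j (toR z) := by
    rw [hbval]; exact div_nonneg (mul_nonneg hℓ.le (by linarith)) (by linarith)
  have hbρ : bco v P.gr.ℓ j (toR z) ≤ (𝔠).ρb := by
    rw [hbval, div_le_iff₀ (by linarith)]
    have h1 : (stdc v j (toR z)).1 < δ := (le_abs_self _).trans_lt hx1
    nlinarith [abs_nonneg (stdc v j (toR z)).2]
  have htI : P.sgn hv hvb j * uco v j (toR z) ∈ Icc (-(𝔠).u₀) (𝔠).u₀ := by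
    have : |P.sgn hv hvb j * uco v j (toR z)| ≤ (𝔠).u₀ := by
      rw [hs.abs_mul]
      show |(stdc v j (toR z)).2| ≤ _
      linarith
    exact ⟨(abs_le.1 this).1, (abs_le.1 this).2⟩
  have hwK : toR z ∈ P.vK hv hvb ho j := ⟨(_, _), ⟨⟨hb0, hbρ⟩, htI⟩, hrepr⟩
  refine mem_iUnion.2 ⟨j, hwK, ?_, ?_⟩
  · have h := P.vb_spt hv hvb ho j (bco v P.gr.ℓ j (toR z)) htI
    rw [hrepr, toC_toR] at h
    rw [h]
    refine ⟨mul_nonneg (div_pos hρ hρb).le hb0, ?_⟩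
    calc (𝔠).ρ / (𝔠).ρb * bco v P.gr.ℓ j (toR z) ≤ (𝔠).ρ / (𝔠).ρb * (𝔠).ρb :=
          mul_le_mul_of_nonneg_left hbρ (div_pos hρ hρb).le
      _ = (𝔠).ρ := div_mul_cancel₀ _ hρb.ne'
  · have h := hHδ (hwv.trans_le hδ₁')
    rw [Hv_self, Real.dist_eq, sub_zero, abs_lt] at h
    exact ⟨h.1.le, h.2.le⟩

/-! ## Gluing of the sectors -/

/-- **Consecutive sectors meet along a half axis** (seen from the first sector). [folklore] -/
theorem vS_inter_succ (j : ZMod 4) :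
    P.vS hv hvb ho j ∩ P.vS hv hvb ho (j + 1) =
      {z ∈ P.vS hv hvb ho j | P.vb hv hvb ho j z = 0 ∧ 0 ≤ P.sgn hv hvb j * P.vH hv hvb z} := by
  ext z
  constructor
  · rintro ⟨hz, hz'⟩
    obtain ⟨b, hb, t, ht, hzt, hbz⟩ := exists_param hz
    have hmem : spt v P.gr.ℓ j (P.sgn hv hvb j) (b, t) ∈ P.vK hv hvb ho (j + 1) := by rw [hzt]; exact hz'.1
    obtain ⟨rfl, hst⟩ := fst_eq_zero_of_mem_vK_succ hb ht hmem
    refine ⟨hz, by rw [hbz, mul_zero], ?_⟩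
    show 0 ≤ P.sgn hv hvb j * P.Hv hv hvb (toR z)
    rw [← hzt]
    exact (P.sgn_mul_Hv_axis_nonneg_iff hv hvb ho j (P.isSg_sgn hv hvb j) ht).2 hst
  · rintro ⟨hz, hb0, hsH⟩
    obtain ⟨b, hb, t, ht, hzt, hbz⟩ := exists_param hz
    have hb' : b = 0 := by
      rw [hbz] at hb0
      exact (mul_eq_zero.1 hb0).resolve_left (div_pos (𝔠).ρ_pos (𝔠).ρb_pos).ne'
    subst hb'
    have hst : 0 ≤ P.sgn hv hvb j * t := by
      refine (P.sgn_mul_Hv_axis_nonneg_iff hv hvb ho j (P.isSg_sgn hv hvb j) ht).1 ?_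
      rw [hzt]; exact hsH
    refine ⟨hz, ?_⟩
    have heq : spt v P.gr.ℓ (j + 1) (P.sgn hv hvb (j + 1)) (0, t) = toR z := by
      rw [P.spt_axis_succ' hv hvb j t hst, hzt]
    have hH : P.Hv hv hvb (spt v P.gr.ℓ (j + 1) (P.sgn hv hvb (j + 1)) (0, t)) ∈ Icc (-(𝔠).ρ) (𝔠).ρ := by
      rw [heq]; exact hz.2.2
    have := P.toC_spt_axis_mem hv hvb ho ht hH
    rwa [heq, toC_toR] at this

/-- **Consecutive sectors meet along a half axis** (seen from the second sector). [folklore] -/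
theorem vS_inter_succ' (j : ZMod 4) :
    P.vS hv hvb ho j ∩ P.vS hv hvb ho (j + 1) =
      {z ∈ P.vS hv hvb ho (j + 1) | P.vb hv hvb ho (j + 1) z = 0 ∧ 0 ≤ P.sgn hv hvb j * P.vH hv hvb z} := by
  ext z
  constructor
  · rintro ⟨hz, hz'⟩
    have h := (P.vS_inter_succ hv hvb ho j).subset ⟨hz, hz'⟩
    obtain ⟨-, -, hsH⟩ := h
    obtain ⟨b, hb, t, ht, hzt, hbz⟩ := exists_param hz'
    have hmem : spt v P.gr.ℓ (j + 1) (P.sgn hv hvb (j + 1)) (b, t) ∈ P.vK hv hvb ho j := by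
      rw [hzt]; exact hz.1
    obtain ⟨rfl, -⟩ := fst_eq_zero_of_mem_vK_pred hb ht hmem
    exact ⟨hz', by rw [hbz, mul_zero], hsH⟩
  · rintro ⟨hz', hb0, hsH⟩
    obtain ⟨b, hb, t, ht, hzt, hbz⟩ := exists_param hz'
    have hb' : b = 0 := by
      rw [hbz] at hb0
      exact (mul_eq_zero.1 hb0).resolve_left (div_pos (𝔠).ρ_pos (𝔠).ρb_pos).ne'
    subst hb'
    have hst : 0 ≤ P.sgn hv hvb j * t := by
      refine (P.sgn_mul_Hv_axis_nonneg_iff hv hvb ho (j + 1) (P.isSg_sgn hv hvb j) ht).1 ?_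
      rw [hzt]; exact hsH
    refine ⟨?_, hz'⟩
    have heq : spt v P.gr.ℓ j (P.sgn hv hvb j) (0, t) = toR z := by
      rw [← P.spt_axis_succ' hv hvb j t hst, hzt]
    have hH : P.Hv hv hvb (spt v P.gr.ℓ j (P.sgn hv hvb j) (0, t)) ∈ Icc (-(𝔠).ρ) (𝔠).ρ := by
      rw [heq]; exact hz'.2.2
    have := P.toC_spt_axis_mem hv hvb ho ht hH
    rwa [heq, toC_toR] at this

/-- **The axis of a sector is covered by its two neighbours.** [folklore] -/
theorem vS_axis_subset (j : ZMod 4) :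
    {z ∈ P.vS hv hvb ho j | P.vb hv hvb ho j z = 0} ⊆ P.vS hv hvb ho (j - 1) ∪ P.vS hv hvb ho (j + 1) := by
  rintro z ⟨hz, hb0⟩
  obtain ⟨b, hb, t, ht, hzt, hbz⟩ := exists_param hz
  have hb' : b = 0 := by
    rw [hbz] at hb0
    exact (mul_eq_zero.1 hb0).resolve_left (div_pos (𝔠).ρ_pos (𝔠).ρb_pos).ne'
  subst hb'
  rcases le_total 0 (P.sgn hv hvb j * t) with hst | hst
  · right
    have heq : spt v P.gr.ℓ (j + 1) (P.sgn hv hvb (j + 1)) (0, t) = toR z := by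
      rw [P.spt_axis_succ' hv hvb j t hst, hzt]
    have hH : P.Hv hv hvb (spt v P.gr.ℓ (j + 1) (P.sgn hv hvb (j + 1)) (0, t)) ∈ Icc (-(𝔠).ρ) (𝔠).ρ := by
      rw [heq]; exact hz.2.2
    have := P.toC_spt_axis_mem hv hvb ho ht hH
    rwa [heq, toC_toR] at this
  · left
    have hsg : P.sgn hv hvb j = -P.sgn hv hvb (j - 1) := by
      have := P.sgn_add_one hv hvb (j - 1); rwa [sub_add_cancel] at this
    have hst' : 0 ≤ P.sgn hv hvb (j - 1) * t := by rw [hsg] at hst; linarith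
    have heq : spt v P.gr.ℓ (j - 1) (P.sgn hv hvb (j - 1)) (0, t) = toR z := by
      rw [← P.spt_axis_succ' hv hvb (j - 1) t hst']
      simp only [sub_add_cancel]
      exact hzt
    have hH : P.Hv hv hvb (spt v P.gr.ℓ (j - 1) (P.sgn hv hvb (j - 1)) (0, t)) ∈ Icc (-(𝔠).ρ) (𝔠).ρ := by
      rw [heq]; exact hz.2.2
    have := P.toC_spt_axis_mem hv hvb ho ht hH
    rwa [heq, toC_toR] at this

/-- **Off `v`, only consecutive sectors meet.** [folklore] -/
theorem eq_of_mem_vS_inter (i j : ZMod 4) {z : ℂ} (hz : z ∈ P.vS hv hvb ho i ∩ P.vS hv hvb ho j)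
    (hne : z ≠ toC v) : j = i ∨ j = i + 1 ∨ i = j + 1 := by
  obtain ⟨k, rfl⟩ : ∃ k, j = i + k := ⟨j - i, by ring⟩
  have hk : ∀ k : ZMod 4, k = 0 ∨ k = 1 ∨ k = 2 ∨ k = 3 := by decide
  rcases hk k with rfl | rfl | rfl | rfl
  · left; rw [add_zero]
  · right; left; rfl
  · exfalso
    have h1 := abs_stdc_snd_le hz.1.1
    have h2 := abs_stdc_snd_le hz.2.1
    rw [stdc_add_two] at h2
    simp only [abs_neg] at h2
    have hx1 : (stdc v i (toR z)).1 = 0 := by linarith [h1.1, h2.1, abs_nonneg (stdc v i (toR z)).2]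
    have hx2 : (stdc v i (toR z)).2 = 0 := by
      have : |(stdc v i (toR z)).2| ≤ 0 := by linarith [h1.1, h2.1]
      exact abs_nonpos_iff.1 this
    have h0 : stdc v i (toR z) = 0 := Prod.ext hx1 hx2
    exact hne (by rw [← toC_toR z, eq_of_stdc_eq_zero h0])
  · right; right
    rw [add_assoc, show (3 : ZMod 4) + 1 = 0 from rfl, add_zero]

/-! ## The sectors and the carrier -/

/-- Off `v`, the points of the sectors are in the carrier. [folklore] -/
theorem toR_mem_X₀ {j : ZMod 4} {z : ℂ} (hz : z ∈ P.vS hv hvb ho j) (hne : z ≠ toC v) : toR z ∈ P.gr.X₀ := by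
  rw [P.gr.mem_X₀_iff]
  have hdist : dist (toR z) v < (𝔠).r := P.dist_lt_of_mem_vK hv hvb ho hz.1
  have hne' : toR z ≠ v := fun h ↦ hne (by rw [← toC_toR z, h])
  refine ⟨P.closedBall_subset_bigBall (𝔠).r_gap (mem_closedBall.2 hdist.le), fun hc ↦ ?_, fun hc ↦ ?_⟩
  · have h := P.gr.le_dist_of_mem_punct (Or.inl hc) (Or.inr hv) hne'
    linarith [(𝔠).r_le]
  · have h := P.gr.le_dist_of_mem_punct (Or.inr hc) (Or.inr hv) hne'
    linarith [(𝔠).r_le]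

/-- Off `v`, the sectors lie in the range of the plane embedding. [folklore] -/
theorem vS_diff_subset_range (j : ZMod 4) : P.vS hv hvb ho j \ {toC v} ⊆ range P.gr.planeEmb := by
  rintro z ⟨hz, hne⟩
  exact ⟨⟨toR z, P.toR_mem_X₀ hv hvb ho hz hne⟩, P.planeEmb_mk _⟩

omit [NormedSpace ℝ B] in
include hv in
/-- `v` is not in the range of the plane embedding. [folklore] -/
theorem toC_not_mem_range : toC v ∉ range P.gr.planeEmb := by
  rintro ⟨y, hy⟩
  have h := P.toR_planeEmb y
  rw [hy, toR_toC] at h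
  have hy' : (y : ℝ × ℝ) ∈ P.gr.vertices := by rw [← h]; exact hv
  exact ((P.gr.mem_X₀_iff).1 y.2).2.2 hy'

/-! ## The sectors are foliated -/

/-- **The sectors are foliated by the contour foliation**: near each point, the height of a
chart of the contour foliation increases with the common height `Hv` (description of the
atlas, `chart_height`, and the transverse orientation of `F`). [folklore] -/
theorem vS_foliated (j : ZMod 4) (x : P.gr.X₀) (hx : P.gr.planeEmb x ∈ P.vS hv hvb ho j) :
    ∃ e ∈ (P.contourFol ho).atlas, x ∈ e.source ∧ ∃ U ∈ 𝓝 x,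
      ∀ y ∈ U, P.gr.planeEmb y ∈ P.vS hv hvb ho j → ∀ z ∈ U, P.gr.planeEmb z ∈ P.vS hv hvb ho j →
        ((e y).2 < (e z).2 ↔ P.vH hv hvb (P.gr.planeEmb y) < P.vH hv hvb (P.gr.planeEmb z)) := by
  haveI := P.gr.nonempty_X₀
  obtain ⟨d, hd, hxd⟩ := (P.contourFol ho).exists_mem_source x
  refine ⟨d, hd, hxd, ?_⟩
  obtain ⟨d₀, hd₀, rfl⟩ := hd
  obtain ⟨c, hc, p, r, hr, hbox, rfl⟩ := hd₀
  obtain ⟨ĉ, hĉ, rfl⟩ := hc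
  obtain ⟨q', hq'⟩ := P.chart_height ho hĉ
  have hsrc : ∀ y : P.gr.X₀,
      y ∈ (orientChart P.gr.planeEmb (renormBox (ĉ.subtypeRestr P.gr.nonempty_X₀) p r hr)).source →
      y ∈ (renormBox (ĉ.subtypeRestr P.gr.nonempty_X₀) p r hr).source ∧ (y : ℝ × ℝ) ∈ ĉ.source := by
    intro y hy
    rw [orientChart_source] at hy
    refine ⟨hy, ?_⟩
    obtain ⟨hyc, -⟩ := mem_renormBox_source_iff.1 hy
    rwa [OpenPartialHomeomorph.subtypeRestr_source] at hyc
  have hK : ∀ y : P.gr.X₀, P.gr.planeEmb y ∈ P.vS hv hvb ho j →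
      P.fill P.apex (y : ℝ × ℝ) ∈ (P.box (P.q₀ hv hvb)).source := by
    intro y hy
    apply P.fill_mem_source_of_mem_closedBall hv hvb
    have := P.vK_subset_closedBall hv hvb ho j hy.1
    rw [toR_planeEmb] at this
    exact closedBall_subset_closedBall (𝔠).r_le this
  obtain ⟨-, hxĉ⟩ := hsrc x hxd
  have hfx : P.fill P.apex (x : ℝ × ℝ) ∈ (P.box q').source := (hq' _ hxĉ).1
  have hfx₀ := hK x hx
  obtain ⟨U₁, hU₁, h₁⟩ := ho _ (P.box_mem q') _ (P.box_mem (P.q₀ hv hvb)) _ ⟨hfx, hfx₀⟩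
  obtain ⟨U₂, hU₂, h₂⟩ := ho _ (P.box_mem (P.q₀ hv hvb)) _ (P.box_mem q') _ ⟨hfx₀, hfx⟩
  have hcont : ContinuousAt (fun y : P.gr.X₀ ↦ P.fill P.apex (y : ℝ × ℝ)) x := P.continuous_fill_coe.continuousAt
  refine ⟨(orientChart P.gr.planeEmb (renormBox (ĉ.subtypeRestr P.gr.nonempty_X₀) p r hr)).source ∩
      (fun y : P.gr.X₀ ↦ P.fill P.apex (y : ℝ × ℝ)) ⁻¹' (U₁ ∩ U₂),
    inter_mem ((OpenPartialHomeomorph.open_source _).mem_nhds hxd)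
      (hcont.preimage_mem_nhds (inter_mem hU₁ hU₂)), ?_⟩
  rintro y ⟨hye, hyU⟩ hyS z ⟨hze, hzU⟩ hzS
  obtain ⟨hyr, hyĉ⟩ := hsrc y hye
  obtain ⟨hzr, hzĉ⟩ := hsrc z hze
  obtain ⟨hfy, hhy⟩ := hq' _ hyĉ
  obtain ⟨hfz, hhz⟩ := hq' _ hzĉ
  have hfy₀ := hK y hyS
  have hfz₀ := hK z hzS
  rw [orientChart_snd, orientChart_snd, renormBox_snd_lt_iff hyr hzr]
  show (ĉ (y : ℝ × ℝ)).2 < (ĉ (z : ℝ × ℝ)).2 ↔ _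
  rw [hhy, hhz]
  have hiff : height (P.box q') (P.fill P.apex (y : ℝ × ℝ)) < height (P.box q') (P.fill P.apex (z : ℝ × ℝ)) ↔
      height (P.box (P.q₀ hv hvb)) (P.fill P.apex (y : ℝ × ℝ)) <
        height (P.box (P.q₀ hv hvb)) (P.fill P.apex (z : ℝ × ℝ)) :=
    ⟨fun h ↦ h₁ _ ⟨hyU.1, hfy, hfy₀⟩ _ ⟨hzU.1, hfz, hfz₀⟩ h,
      fun h ↦ h₂ _ ⟨hyU.2, hfy₀, hfy⟩ _ ⟨hzU.2, hfz₀, hfz⟩ h⟩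
  rw [hiff]
  simp only [vH, toR_planeEmb, Hv, sub_lt_sub_iff_right]

end Geometry

/-! ## The vertex star -/

/-- **The contour foliation at an interior vertex is a four-prong star** (the `C⁰` saddle of a
disc in general position at a vertex of the triangulation, Camacho–Lins Neto Ch. VI §2).
[cite: CamachoLinsNeto1985, Ch. VI §2] -/
def vertexStar : ProngStar (P.contourFol ho) P.gr.planeEmb (toC v) 4 where
  S := P.vS hv hvb ho
  b := P.vb hv hvb ho
  H := P.vH hv hvb
  sg := P.sgn hv hvb
  ρ := (𝔠).ρ
  ρ_pos := (𝔠).ρ_pos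
  sg_sq := P.isSg_sgn hv hvb
  sg_succ := P.sgn_add_one hv hvb
  isCompact := P.isCompact_vS hv hvb ho
  mem := P.toC_mem_vS hv hvb ho
  iUnion_mem_nhds := P.iUnion_vS_mem_nhds hv hvb ho
  H_v := P.vH_v hv hvb
  b_v := P.vb_v hv hvb ho
  continuousOn_H := P.continuousOn_vH hv hvb ho
  continuousOn_b := P.continuousOn_vb hv hvb ho
  injOn := P.injOn_chart hv hvb ho
  image_eq := P.image_chart hv hvb ho
  inter_succ := P.vS_inter_succ hv hvb ho
  inter_succ' := P.vS_inter_succ' hv hvb ho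
  axis_subset := P.vS_axis_subset hv hvb ho
  eq_of_mem_inter i j _ hz hne := P.eq_of_mem_vS_inter hv hvb ho i j hz hne
  diff_subset_range := P.vS_diff_subset_range hv hvb ho
  not_mem_range := P.toC_not_mem_range hv
  foliated := P.vS_foliated hv hvb ho

/-- The sectors of the vertex star. [folklore] -/
@[simp] theorem vertexStar_S : (P.vertexStar hv hvb ho).S = P.vS hv hvb ho := rfl

/-- The height of the vertex star is the common height. [folklore] -/
@[simp] theorem vertexStar_H (z : ℂ) : (P.vertexStar hv hvb ho).H z = P.Hv hv hvb (toR z) := rfl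

/-- The signs of the vertex star. [folklore] -/
@[simp] theorem vertexStar_sg : (P.vertexStar hv hvb ho).sg = P.sgn hv hvb := rfl

/-- The size of the vertex star. [folklore] -/
@[simp] theorem vertexStar_ρ : (P.vertexStar hv hvb ho).ρ = (𝔠).ρ := rfl

end Foliation.ConePosition

end Literature.Topology.FourManifolds
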